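import Summits.AtomisticToContinuum.Crystallization.Theorems.OverbindingBudgetEnergyHeightsOsc
import Summits.AtomisticToContinuum.Crystallization.Theorems.OverbindingBudgetEnergyAffineTable

/-!
# OverbindingBudget · decomp-a2c lens-4 g35 — part XXIII-Z₃: COARSE-REG-T ⟹ R3geo; cone XXXVIII

Helper file under `--supports stmt-AtomisticToContinuum-31280` (RDEF = `Theses.OverbindingBudget.RobustDefectLimitWindows`); closes nothing.

* `registryGeometryW_of_coarse`: part Z₂'s COARSE-REG-T `CoarseRegistryT Λ₁ h₀ τ₀` (unpinned, positive normal as input) implies the registry side's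
  R3geo `RegistryGeometryW Λ₁ s₁ s₂ h₀ τ₀` over every box with `289 s₂² ≤ 388 s₁²`, `0 ≤ s₁` (a pinned cell is then T-type by the law of cosines:
  `isTType_of_pinned`) — so ONE geometric localisation serves both sides of the cone.
* Cone XXXVIII `rdef_thirtyeighth_of_recordK_cert_ref` = cone XXXVII `…EnergyAffineTable.rdef_thirtyseventh_of_recordK_table_ref` with GEO-OSC
  `StackedHeightsOsc (17/16) ω` supplied by part Z₂'s ★ `stackedHeightsOsc_of_coarse_cert` (`2ω₀ ≤ ω`) and R3geo by `registryGeometryW_of_coarse`: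
  beneath ★ `StackedCellPinningU` the per-configuration leaves are now ONLY COARSE-REG-T/S [GEOMETRY·S/M]; the rest of the energy side is finite
  certificates (FORCE-CERT-T/S multi-stage force rows of part Z₁, TAB-T/S affine tables of part XXXVII).  Binders: the cone's `κ' ω B s₀ s₁ s₂ h₀`
  plus `h₁ τ' τ'' ω₀` (S-type coarse height, fine-reference offsets, certified half-width with `2ω₀ ≤ ω`); side conditions `0 ≤ s₁`,
  `289 s₂² ≤ 388 s₁²` (the pinned box is T-type; the box of record `[0.966, 0.976]` qualifies).
-/

noncomputable section

namespace Summit.AtomisticToContinuum.Crystallization.Theorems.OverbindingBudgetEnergyHeightsOscCone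

open scoped RealInnerProductSpace
open Summit.AtomisticToContinuum.Crystallization.Theses.OverbindingBudget (RobustDefectLimitWindows)
open Summit.AtomisticToContinuum.Crystallization.Theses.PricedLinkCensus (ChargedEnergyGap)
open Summit.AtomisticToContinuum.Crystallization.Theorems.ChargedEnergyGapNegative (eStar)
open Summit.AtomisticToContinuum.Crystallization.Theorems.OverbindingBudgetGradedBareness (CleanlessExcessT)
open Summit.AtomisticToContinuum.Crystallization.Theorems.OverbindingBudgetCoherentCut (CoherentResidual)
open Summit.AtomisticToContinuum.Crystallization.Theorems.OverbindingBudgetUniformCutStatements (GrossCleanBallsU)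
open Summit.AtomisticToContinuum.Crystallization.Theorems.OverbindingBudgetElasticSplitScale (CompressedVirialLaw)
open Summit.AtomisticToContinuum.Crystallization.Theorems.ChartedPlanarOrderChunkFloor (E3)
open Summit.AtomisticToContinuum.Crystallization.Theorems.OverbindingBudgetScaleWidening (DoorPeriodicW)
open Summit.AtomisticToContinuum.Crystallization.Theorems.OverbindingBudgetTwoShellShape (TwoShellShape BarlowGluingW)
open Summit.AtomisticToContinuum.Crystallization.Theorems.OverbindingBudgetStackedRigidityW (StackedReductionW GapStressVanishesW)
open Summit.AtomisticToContinuum.Crystallization.Theorems.OverbindingBudgetRegistryCut (Pinned RegistryResidual RegistryTube)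
open Summit.AtomisticToContinuum.Crystallization.Theorems.OverbindingBudgetRegistryDichotomy (IsTType RegistryGeometryW BalancedLocus)
open Summit.AtomisticToContinuum.Crystallization.Theorems.OverbindingBudgetRegistryDichotomyCW (RegistryMetricCW)
open Summit.AtomisticToContinuum.Crystallization.Theorems.OverbindingBudgetEnergyTubeBox (RegistryPinningP TubeConvexRefP)
open Summit.AtomisticToContinuum.Crystallization.Theorems.OverbindingBudgetEnergyStraightening (exists_unitNormal_of_isStacked)
open Summit.AtomisticToContinuum.Crystallization.Theorems.OverbindingBudgetEnergyAffineTable (AffineTableT AffineTableS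
  rdef_thirtyseventh_of_recordK_table_ref)
open Summit.AtomisticToContinuum.Crystallization.Theorems.OverbindingBudgetEnergyHeightsOsc (CoarseRegistryT CoarseRegistryS ForceCertT ForceCertS
  stackedHeightsOsc_of_coarse_cert)

/-! ## §1 COARSE-REG-T feeds R3geo `RegistryGeometryW` on every near-equilateral box -/

/-- a pinned cell with `289 s₂² ≤ 388 s₁²`, `0 ≤ s₁` is T-type. [bookkeeping: law of cosines] -/
theorem isTType_of_pinned {s₁ s₂ : ℝ} (hs₁ : 0 ≤ s₁) (hs : 289 * s₂ ^ 2 ≤ 388 * s₁ ^ 2) {a b : E3} (h : Pinned s₁ s₂ a b) : IsTType a b := by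
  obtain ⟨ha1, ha2, hb1, hb2, hab⟩ := h
  have haa : s₁ ^ 2 ≤ ‖a‖ ^ 2 := pow_le_pow_left₀ hs₁ ha1 2
  have hbb : s₁ ^ 2 ≤ ‖b‖ ^ 2 := pow_le_pow_left₀ hs₁ hb1 2
  have ha2' : ‖a‖ ^ 2 ≤ s₂ ^ 2 := pow_le_pow_left₀ (norm_nonneg _) ha2 2
  unfold IsTType
  rcases hab with ⟨-, hm⟩ | ⟨-, hp⟩
  · have e : ‖a - b‖ ^ 2 = ‖a‖ ^ 2 - 2 * ⟪a, b⟫ + ‖b‖ ^ 2 := norm_sub_sq_real a b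
    have hm2 : ‖a - b‖ ^ 2 ≤ s₂ ^ 2 := pow_le_pow_left₀ (norm_nonneg _) hm 2
    have hin : 95 / 289 * ‖a‖ ^ 2 ≤ ⟪a, b⟫ := by nlinarith
    exact hin.trans (le_abs_self _)
  · have e : ‖a + b‖ ^ 2 = ‖a‖ ^ 2 + 2 * ⟪a, b⟫ + ‖b‖ ^ 2 := norm_add_sq_real a b
    have hp2 : ‖a + b‖ ^ 2 ≤ s₂ ^ 2 := pow_le_pow_left₀ (norm_nonneg _) hp 2
    have hin : 95 / 289 * ‖a‖ ^ 2 ≤ -⟪a, b⟫ := by nlinarith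
    exact hin.trans (neg_le_abs _)

/-- ★ **COARSE-REG-T ⟹ R3geo** over a box `[s₁, s₂]` with `289 s₂² ≤ 388 s₁²` (e.g. the box of record `[0.966, 0.976]`): the positive unit normal of
the stacked representation is the witness. [this file] -/
theorem registryGeometryW_of_coarse {Λ₁ h₀ τ₀ s₁ s₂ : ℝ} (hs₁ : 0 ≤ s₁) (hs : 289 * s₂ ^ 2 ≤ 388 * s₁ ^ 2) (hCT : CoarseRegistryT Λ₁ h₀ τ₀) :
    RegistryGeometryW Λ₁ s₁ s₂ h₀ τ₀ := by
  intro δ hδ a b w hst hab ha hb hs' hc hna hf hz hp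
  obtain ⟨n, hn, hpos⟩ := exists_unitNormal_of_isStacked hst
  obtain ⟨σ, u, v, h⟩ := hCT δ hδ a b w hst hab ha hb hs' hc hna hf hz (isTType_of_pinned hs₁ hs hp) n hn hpos
  exact ⟨n, σ, u, v, hn, h⟩

/-! ## §2 Cone XXXVIII: cone XXXVII with GEO-OSC and R3geo supplied by COARSE-REG ∧ FORCE-CERT -/

/-- **Cone XXXVIII** (= cone XXXVII `…EnergyAffineTable.rdef_thirtyseventh_of_recordK_table_ref` with GEO-OSC `StackedHeightsOsc (17/16) ω` supplied by
★ `stackedHeightsOsc_of_coarse_cert` and R3geo `RegistryGeometryW (17/16) s₁ s₂ h₀ (3/20)` by `registryGeometryW_of_coarse`): beneath ★ `StackedCellPinningU`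
the per-configuration leaves are now ONLY the two coarse registry localisations COARSE-REG-T/S [GEOMETRY·S/M]; everything else on the energy side is a
finite certificate (FORCE-CERT-T/S, TAB-T/S) or registry-side. [this file] -/
theorem rdef_thirtyeighth_of_recordK_cert_ref (s₁ s₂ h₀ h₁ τ' τ'' κ' ω₀ ω B : ℝ) (s₀ : ℕ) (hκ' : 0 < κ') (hω : 0 < ω) (hω₀ : 2 * ω₀ ≤ ω)
    (hs₀ : 4 ≤ s₀) (hs₁ : 0 ≤ s₁) (hs : 289 * s₂ ^ 2 ≤ 388 * s₁ ^ 2)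
    (hG : GrossCleanBallsU (1 / 250) 10)
    (hCEG : ChargedEnergyGap) (hC : CompressedVirialLaw (1 / 250) 10) (hS : TwoShellShape (1 / 100) (3 / 50) (1 / 450)) (hB₂ : BarlowGluingW)
    (hD : DoorPeriodicW 2) (hSR : StackedReductionW 2 (17 / 16)) (hV : GapStressVanishesW (17 / 16))
    (hP : RegistryPinningP (17 / 16) (1 / 40) (3 / 16) s₁ s₂ 1 0) (hT : TubeConvexRefP (17 / 16) (1 / 40) s₁ s₂ 1 0)
    (hCT : CoarseRegistryT (17 / 16) h₀ (3 / 20)) (hFT : ForceCertT h₀ (3 / 20) τ' ω₀)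
    (hCS : CoarseRegistryS (17 / 16) h₁ (3 / 20)) (hFS : ForceCertS h₁ (3 / 20) τ'' ω₀)
    (hTT : AffineTableT (17 / 16) s₁ s₂ ω s₀ B (eStar + 2 * κ')) (hTS : AffineTableS (17 / 16) ω s₀ B (eStar + 2 * κ'))
    (hBal : BalancedLocus s₁ s₂ h₀ (1 / 40)) (hR1 : RegistryResidual s₁ s₂ (1 / 250)) (hR2 : RegistryTube s₁ s₂ (1 / 100) 1)
    (hMet : RegistryMetricCW s₁ s₂ (3 / 500)) (hCE : CleanlessExcessT) (hRes : CoherentResidual 10) : RobustDefectLimitWindows :=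
  rdef_thirtyseventh_of_recordK_table_ref s₁ s₂ h₀ κ' ω B s₀ hκ' hω hs₀ hG hCEG hC hS hB₂ hD hSR hV hP hT
    (stackedHeightsOsc_of_coarse_cert le_rfl hω₀ hCT hFT hCS hFS) hTT hTS (registryGeometryW_of_coarse hs₁ hs hCT) hBal hR1 hR2 hMet hCE hRes

end Summit.AtomisticToContinuum.Crystallization.Theorems.OverbindingBudgetEnergyHeightsOscCone

end
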